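/-
Copyright: the b2b-balaban T⁴-continuum CRUX team, row NE7b OWNER lineage `t4-ne7b-p1` (gen 120). Project licence.
-/
import Summits.QuantumFields.BalabanUV.T4Continuum.Spine.NE7b.SupTorusCoarseFloor

/-!
# THE RESPONSE TO A UNIT COARSE SOURCE IS EXPONENTIALLY LOCAL IN BLOCK MEAN SQUARE — every field of the two-sided class, every mesh,
# every volume: for `H = (n+1)²(−Δ) + a(n+1)^{−d}(block sums) + V`, `−λ ≤ V ≤ Λ`, the fine field `h_{y₀} = Σ_{y′}T⁻¹(y′,y₀)ψ_{y′}` (`T` the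
# Schur complement of (134); the two displays `Q′t h_{y₀} = e_{y₀}`, `Hh_{y₀}` block-constant DEFINE the road's response `Dt e_{y₀}` of (100))
# satisfies `(n+1)^{−d}Σ_{z} h_{y₀}(σ(chart (wm y) z))² ≤ C·e^{−2δρ_s(y,y₀)}` with `(C, δ)` depending on `(d, a, λ, Λ)` ONLY — the block-`ℓ²`
# sequel of the locality column named in § [NE7bP1-G120-HANDOFF] NEXT (3)(a) (row NE7b, node U5c; (131)–(135) BY NAME; [folklore])

Cell `pub-balaban`, sub-cell `t4`, spine estimate NE7b (`T4WeightBudget.RelWeightBound`; the cell's OWN estimate — NOT PRINTED in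
[Bałaban 1983–89], NOT PROVED).  Crux-route work under `Spine/NE7b/` by the row OWNER (`t4-ne7b-p1` gen 120, file (137)) under FREEZE
(0)'s crux-prover clause; NOTHING of Bałaban's is named as a Lean object, valued or asserted; no `T4Continuum/Support` leaf typed; no `def`,
no notation (the response is WRITTEN OUT as the superposition `Σ_{y′}T⁻¹(y′,y₀)ψ_{y′}` of the block columns, `T⁻¹` Mathlib's inverse of
`Matrix.of T`); zero `sorry`.  Imports (BY NAME): the OWNER's (135) `…SupTorusCoarseFloor` (`coarse_floor`, `nextScale_hessian_local`; through
it (134), (133) `action_sum_smul`, `block_sum_le_total`, `weight_on_block`, (132) `torusDist_bond_lipschitz`, `isPseudoDist_torus`,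
`torus_sum_exp_le`, (131) `inverseHessian_weighted_resolvent`, `exists_rate`, (89) TDF `sum_blockLift_mul`), Mathlib's
`Matrix.mulVec_injective_iff_isUnit`, `Matrix.mul_nonsing_inv`.

WHY (located).  (135)∕(136) localise the next-scale Hessian `T⁻¹` (`= Mt`); the RESPONSE `Dt e_{y₀} = H⁻¹((T⁻¹e_{y₀})∘bt)` is `H⁻¹` applied
to an EXPONENTIALLY DECAYING block-constant source, so (131)'s weighted resolvent letter with the weight `(κ∕(n+1))ρ_N(·, corner y₀)` applies
once the source's weighted norm is controlled: `Σ_x (e^{w}c(bt x))² = Σ_{y′}c(y′)²Σ_z e^{2w} ≤ c₁²(n+1)^d e^{2dκ}Σ_{y′}e^{−(2δ₁ − 2κ)ρ_s(y′,y₀)}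
≤ c₁²(n+1)^d e^{2dκ}K` for `2κ ≤ δ₁` ((133) `weight_on_block`, (132) `torus_sum_exp_le`); reading the solution's weighted norm on the
block `y` ((133) `block_sum_le_total`, weights `≥ e^{κρ_s(y,y₀) − dκ}`) gives the block sum of squares `≤ m_κ⁻²c₁²(n+1)^d e^{4dκ}K
e^{−2κρ_s(y,y₀)}` — per-site mean square MESH-FREE.  The rate is `κ = min(κ₀, δ₁∕2)` with `κ₀` from (131) `exists_rate` (floor `≥
(min(2,a) − λ)∕2`, monotone in the rate) and `(c₁, δ₁)` from (135).  Invertibility of `T` (for `Q′t h_{y₀} = e_{y₀}`, i.e. `T·T⁻¹ = 1`) is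
the coarse floor ((135) `coarse_floor`: `T.mulVec` injective ⟹ `IsUnit T`).  A POINTWISE statement would carry `(n+1)^{d∕2}` (no `ℓ^∞`
theory); the block mean square is the honest mesh-free currency.

WHAT IS PROVED ([folklore]; fine torus `Site d ((n+1)s)`, coarse `Site d s`, `[NeZero s]`; the action DISPLAYED; `bt x = σ_s(blk n (wm x))`;
`ρ_s` = (132)'s `ℓ¹` circular distance written out; `K = (2∕(1 − e^{−δ₁}))^d`):
* §1 `rate_mono` (`0 ≤ κ′ ≤ κ ⟹ m_κ ≤ m_{κ′}`), `sum_sq_blockLift_mul` (`Σ_x c(bt x)²F x = Σ_{y′}c(y′)²Σ_z F(σ(chart (wm y′) z))`).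
* §2 **`weighted_blockLift_sq_le`** (`|c y′| ≤ c₁e^{−δ₁ρ_s(y′,y₀)}`, `2κ ≤ δ₁` ⟹ `Σ_x (e^{κρ_N(x, corner y₀)∕(n+1)}c(bt x))² ≤ c₁²(n+1)^d e^{2dκ}K`).
* §3 **`blockSq_le_of_decaying_source`** (`Hh = c∘bt`, `V ≥ −λ`, `0 ≤ κ ≤ 1`, `m_κ > 0` ⟹ over every block `y`:
  `Σ_z h(σ(chart (wm y) z))² ≤ m_κ⁻²·(c₁²(n+1)^d e^{2dκ}K)·e^{2dκ}·e^{−2κρ_s(y,y₀)}`).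
* §4 THE HEADLINE **`response_local`**: `∃ C δ > 0` depending on `(d, a, λ, Λ)` only (`a > 0`, `λ < min(2,a)`, `Λ ≥ 0`) such that for
  ALL `n, s`, ALL `−λ ≤ V ≤ Λ`, ALL block columns `ψ` and every `y₀`, the field `h_{y₀} = Σ_{y′}T⁻¹(y′,y₀)ψ_{y′}` has (i) block means `e_{y₀}`,
  (ii) `Hh_{y₀} = T⁻¹(bt ·, y₀)`, (iii) `(n+1)^{−d}Σ_z h_{y₀}(σ(chart (wm y) z))² ≤ C·e^{−2δρ_s(y,y₀)}` for every block `y`.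
* §5 toy.

HONEST (what this is NOT).  Block-`ℓ²` (per-site mean square) currency, not pointwise; the identification `h_{y₀} = Dt e_{y₀}` with (100)'s
`Dt` is (133) `action_injective` on the two displays (done for `Mt` in (136); not re-typed here); the fluctuation covariance
`H⁻¹ − H⁻¹Q′t*T⁻¹Q′tH⁻¹` is the same computation twice (not typed); two-sided class; constants explicit, far from sharp; cubic periods;
scalar skeleton ((A3), NC-NE7b-α UNRULED); nothing of Bałaban's.  BY-NAME EFFECT ON THE WALL: NONE.  NE7b NOT PRINTED ∕ NOT PROVED; spine
PROVED 0∕9; rung (B)+1 on a FINITE torus — NOT infinite volume, NOT the mass gap, NOT Clay.  HONEST DEPENDENCY: continuum YM on T⁴ ⇐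
BetaPertH ∧ nine spine estimates (0∕9 proved); BetaPertH ⇐ (D1) ∧ (D4) ∧ CAP+tail; G-an2-4 gates asym, D1 and NE2∕3∕4.
-/

set_option autoImplicit false

noncomputable section

namespace Summit.QuantumFields.BalabanUV.T4Continuum.NE7b.SupTorusResponseLocality

open Real
open Literature.MathematicalPhysics.QuantumFieldTheory.Balaban1983to89
open B6QGQLower276 (X e blk B side chart mem_B sum_B sum_B_const card_cube blk_chart)
open Beta (Site siteOf windowMap siteOf_windowMap siteOf_add)
open SupTorusDirichletForm (sum_blockLift_mul blockOf_siteOf_of_mem)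
open SupTorusHessianCombesThomas (inverseHessian_weighted_resolvent exists_rate)
open SupTorusBlockDistance (torusDist_bond_lipschitz isPseudoDist_torus torus_sum_exp_le)
open SupTorusActionForm (action_sum_smul block_sum_le_total weight_on_block)
open SupTorusCoarseFloor (coarse_floor nextScale_hessian_local)

variable {d : ℕ}

/-! ## §1. The rate window is monotone; block sums of block-constant lifts -/

/-- The floor `m_κ = min(2,a) − λ − 2dκ² − a(e^{2dκ} − 1)` is antitone in the rate: `0 ≤ κ′ ≤ κ` ⟹ `m_κ ≤ m_{κ′}` (`a ≥ 0`). [folklore] -/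
theorem rate_mono (a : ℝ) (ha : 0 ≤ a) {lam κ κ' : ℝ} (hκ'0 : 0 ≤ κ') (hκ' : κ' ≤ κ) :
    min 2 a - lam - 2 * d * κ ^ 2 - a * (exp (2 * d * κ) - 1) ≤ min 2 a - lam - 2 * d * κ' ^ 2 - a * (exp (2 * d * κ') - 1) := by
  have hd : (0 : ℝ) ≤ d := Nat.cast_nonneg d
  have h1 : κ' ^ 2 ≤ κ ^ 2 := pow_le_pow_left₀ hκ'0 hκ' 2
  have h2 : exp (2 * d * κ') ≤ exp (2 * d * κ) := exp_le_exp.2 (by nlinarith)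
  nlinarith [mul_le_mul_of_nonneg_left h1 (by positivity : (0 : ℝ) ≤ 2 * d), mul_le_mul_of_nonneg_left h2 ha]

variable (n s : ℕ) [NeZero s]

/-- `Σ_x c(bt x)²·F x = Σ_{y′} c(y′)²·Σ_z F(σ(chart n (wm y′) z))` (TDF `sum_blockLift_mul`). [folklore] -/
theorem sum_sq_blockLift_mul (c : Site d s → ℝ) (F : Site d ((n + 1) * s) → ℝ) :
    ∑ x, c (siteOf d s (blk n (windowMap d ((n + 1) * s) x))) ^ 2 * F x
      = ∑ y' : Site d s, c y' ^ 2 * ∑ z : Fin d → Fin (n + 1), F (siteOf d ((n + 1) * s) (chart n (windowMap d s y') z)) := by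
  rw [sum_blockLift_mul n s (fun y => c y ^ 2) F]
  exact Finset.sum_congr rfl fun y' _ => by rw [sum_B]

/-! ## §2. The weighted norm of an exponentially decaying block-constant source -/

/-- **AN EXPONENTIALLY DECAYING COARSE PROFILE, LIFTED BLOCK-CONSTANTLY, HAS WEIGHTED NORM `≤ c₁²(n+1)^d e^{2dκ}K`** for the weight
`(κ∕(n+1))·ρ_N(·, corner y₀)` when `2κ ≤ δ₁`: `Σ_x (e^{κρ(x)∕(n+1)}c(bt x))² ≤ c₁²(n+1)^d e^{2dκ}(2∕(1 − e^{−δ₁}))^d` if `|c y′| ≤ c₁e^{−δ₁ρ_s(y′,y₀)}`.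
[folklore] -/
theorem weighted_blockLift_sq_le {κ δ₁ c₁ : ℝ} (hκ : 0 ≤ κ) (hδ : 0 < δ₁) (h2κ : 2 * κ ≤ δ₁) (y₀ : Site d s)
    (c : Site d s → ℝ) (hc : ∀ y', |c y'| ≤ c₁ * exp (-(δ₁ * ∑ i, (((y' i - y₀ i).valMinAbs.natAbs : ℕ) : ℝ)))) :
    ∑ x, (exp (κ / ((n : ℝ) + 1) * ∑ i, (((x i - (siteOf d ((n + 1) * s) (chart n (windowMap d s y₀) 0)) i).valMinAbs.natAbs : ℕ) : ℝ))
        * c (siteOf d s (blk n (windowMap d ((n + 1) * s) x)))) ^ 2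
      ≤ c₁ ^ 2 * ((n : ℝ) + 1) ^ d * exp (2 * d * κ) * (2 * (1 - exp (-δ₁))⁻¹) ^ d := by
  classical
  have e1 : ∀ x : Site d ((n + 1) * s),
      (exp (κ / ((n : ℝ) + 1) * ∑ i, (((x i - (siteOf d ((n + 1) * s) (chart n (windowMap d s y₀) 0)) i).valMinAbs.natAbs : ℕ) : ℝ))
        * c (siteOf d s (blk n (windowMap d ((n + 1) * s) x)))) ^ 2
      = c (siteOf d s (blk n (windowMap d ((n + 1) * s) x))) ^ 2
        * exp (κ / ((n : ℝ) + 1) * ∑ i, (((x i - (siteOf d ((n + 1) * s) (chart n (windowMap d s y₀) 0)) i).valMinAbs.natAbs : ℕ) : ℝ)) ^ 2 :=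
    fun x => by ring
  simp only [e1]
  rw [sum_sq_blockLift_mul n s c]
  -- per coarse site: the block sum of the squared weight is `≤ (n+1)^d e^{2(κρ_s(y′,y₀) + dκ)}`
  have hblock : ∀ y' : Site d s, ∑ z : Fin d → Fin (n + 1),
      exp (κ / ((n : ℝ) + 1) * ∑ i, ((((siteOf d ((n + 1) * s) (chart n (windowMap d s y') z)) i
        - (siteOf d ((n + 1) * s) (chart n (windowMap d s y₀) 0)) i).valMinAbs.natAbs : ℕ) : ℝ)) ^ 2
      ≤ ((n : ℝ) + 1) ^ d * exp (2 * (κ * (∑ i, (((y' i - y₀ i).valMinAbs.natAbs : ℕ) : ℝ)) + d * κ)) := by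
    intro y'
    calc ∑ z : Fin d → Fin (n + 1), exp (κ / ((n : ℝ) + 1) * ∑ i, ((((siteOf d ((n + 1) * s) (chart n (windowMap d s y') z)) i
            - (siteOf d ((n + 1) * s) (chart n (windowMap d s y₀) 0)) i).valMinAbs.natAbs : ℕ) : ℝ)) ^ 2
        ≤ ∑ _z : Fin d → Fin (n + 1), exp (2 * (κ * (∑ i, (((y' i - y₀ i).valMinAbs.natAbs : ℕ) : ℝ)) + d * κ)) := by
          refine Finset.sum_le_sum fun z _ => ?_
          rw [← exp_nat_mul, Nat.cast_ofNat]
          exact exp_le_exp.2 (by linarith [(weight_on_block n s y' y₀ z hκ).2])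
      _ = _ := by rw [Finset.sum_const, Finset.card_univ, nsmul_eq_mul, card_cube]
  -- per coarse site: `c(y′)² · block ≤ c₁²(n+1)^d e^{2dκ} e^{−δ₁ρ_s(y′,y₀)}`
  have hterm : ∀ y' : Site d s, c y' ^ 2 * ∑ z : Fin d → Fin (n + 1),
      exp (κ / ((n : ℝ) + 1) * ∑ i, ((((siteOf d ((n + 1) * s) (chart n (windowMap d s y') z)) i
        - (siteOf d ((n + 1) * s) (chart n (windowMap d s y₀) 0)) i).valMinAbs.natAbs : ℕ) : ℝ)) ^ 2
      ≤ c₁ ^ 2 * ((n : ℝ) + 1) ^ d * exp (2 * d * κ) * exp (-(δ₁ * ∑ i, (((y' i - y₀ i).valMinAbs.natAbs : ℕ) : ℝ))) := by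
    intro y'
    have hρ0 : 0 ≤ ∑ i, (((y' i - y₀ i).valMinAbs.natAbs : ℕ) : ℝ) := Finset.sum_nonneg fun _ _ => Nat.cast_nonneg _
    have hc2 : c y' ^ 2 ≤ (c₁ * exp (-(δ₁ * ∑ i, (((y' i - y₀ i).valMinAbs.natAbs : ℕ) : ℝ)))) ^ 2 := by
      rw [← sq_abs (c y')]; exact pow_le_pow_left₀ (abs_nonneg _) (hc y') 2
    have h1 := mul_le_mul hc2 (hblock y') (Finset.sum_nonneg fun _ _ => sq_nonneg _) (sq_nonneg _)
    refine h1.trans ?_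
    have hexp : exp (-(δ₁ * ∑ i, (((y' i - y₀ i).valMinAbs.natAbs : ℕ) : ℝ))) ^ 2
        * exp (2 * (κ * (∑ i, (((y' i - y₀ i).valMinAbs.natAbs : ℕ) : ℝ)) + d * κ))
        ≤ exp (2 * d * κ) * exp (-(δ₁ * ∑ i, (((y' i - y₀ i).valMinAbs.natAbs : ℕ) : ℝ))) := by
      rw [sq, ← exp_add, ← exp_add, ← exp_add]
      exact exp_le_exp.2 (by nlinarith)
    calc (c₁ * exp (-(δ₁ * ∑ i, (((y' i - y₀ i).valMinAbs.natAbs : ℕ) : ℝ)))) ^ 2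
          * (((n : ℝ) + 1) ^ d * exp (2 * (κ * (∑ i, (((y' i - y₀ i).valMinAbs.natAbs : ℕ) : ℝ)) + d * κ)))
        = c₁ ^ 2 * ((n : ℝ) + 1) ^ d * (exp (-(δ₁ * ∑ i, (((y' i - y₀ i).valMinAbs.natAbs : ℕ) : ℝ))) ^ 2
          * exp (2 * (κ * (∑ i, (((y' i - y₀ i).valMinAbs.natAbs : ℕ) : ℝ)) + d * κ))) := by ring
      _ ≤ c₁ ^ 2 * ((n : ℝ) + 1) ^ d * (exp (2 * d * κ) * exp (-(δ₁ * ∑ i, (((y' i - y₀ i).valMinAbs.natAbs : ℕ) : ℝ)))) :=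
          mul_le_mul_of_nonneg_left hexp (by positivity)
      _ = _ := by ring
  -- sum over the coarse torus
  have hsum : ∑ y' : Site d s, exp (-(δ₁ * ∑ i, (((y' i - y₀ i).valMinAbs.natAbs : ℕ) : ℝ))) ≤ (2 * (1 - exp (-δ₁))⁻¹) ^ d := by
    have h := torus_sum_exp_le (d := d) s hδ y₀
    refine le_trans (le_of_eq (Finset.sum_congr rfl fun y' _ => ?_)) h
    rw [(isPseudoDist_torus (d := d) s).symm y' y₀]
  calc ∑ y' : Site d s, c y' ^ 2 * ∑ z : Fin d → Fin (n + 1),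
        exp (κ / ((n : ℝ) + 1) * ∑ i, ((((siteOf d ((n + 1) * s) (chart n (windowMap d s y') z)) i
          - (siteOf d ((n + 1) * s) (chart n (windowMap d s y₀) 0)) i).valMinAbs.natAbs : ℕ) : ℝ)) ^ 2
      ≤ ∑ y' : Site d s, c₁ ^ 2 * ((n : ℝ) + 1) ^ d * exp (2 * d * κ) * exp (-(δ₁ * ∑ i, (((y' i - y₀ i).valMinAbs.natAbs : ℕ) : ℝ))) :=
        Finset.sum_le_sum fun y' _ => hterm y'
    _ = c₁ ^ 2 * ((n : ℝ) + 1) ^ d * exp (2 * d * κ) * ∑ y' : Site d s, exp (-(δ₁ * ∑ i, (((y' i - y₀ i).valMinAbs.natAbs : ℕ) : ℝ))) := by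
        rw [Finset.mul_sum]
    _ ≤ c₁ ^ 2 * ((n : ℝ) + 1) ^ d * exp (2 * d * κ) * (2 * (1 - exp (-δ₁))⁻¹) ^ d :=
        mul_le_mul_of_nonneg_left hsum (by positivity)

/-! ## §3. A solution with an exponentially decaying block-constant source decays in block `ℓ²` -/

/-- **BLOCK `ℓ²` DECAY OF `H⁻¹(c∘bt)` FOR AN EXPONENTIALLY DECAYING COARSE `c`**: if `Hh = c∘bt` (displayed action, `V ≥ −λ`),
`|c y′| ≤ c₁e^{−δ₁ρ_s(y′,y₀)}`, `0 ≤ κ ≤ 1`, `2κ ≤ δ₁`, `m_κ > 0`, then over EVERY block `y`: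
`Σ_z h(σ(chart (wm y) z))² ≤ m_κ⁻²c₁²(n+1)^d e^{4dκ}(2∕(1 − e^{−δ₁}))^d·e^{−2κρ_s(y,y₀)}` — the block mean square is
`≤ (m_κ⁻¹c₁e^{2dκ})²K·e^{−2κρ_s(y,y₀)}`, MESH-FREE. [folklore] -/
theorem blockSq_le_of_decaying_source (a : ℝ) (ha : 0 ≤ a) {lam κ δ₁ c₁ : ℝ} (hκ0 : 0 ≤ κ) (hκ1 : κ ≤ 1)
    (hm : 0 < min 2 a - lam - 2 * d * κ ^ 2 - a * (exp (2 * d * κ) - 1)) (hδ : 0 < δ₁) (h2κ : 2 * κ ≤ δ₁)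
    (V : Site d ((n + 1) * s) → ℝ) (hV : ∀ x, -lam ≤ V x) (y₀ : Site d s) (c : Site d s → ℝ)
    (hc : ∀ y', |c y'| ≤ c₁ * exp (-(δ₁ * ∑ i, (((y' i - y₀ i).valMinAbs.natAbs : ℕ) : ℝ))))
    (h : Site d ((n + 1) * s) → ℝ)
    (hh : ∀ x, ((n : ℝ) + 1) ^ 2 * ∑ μ, (2 * h x - h (x + siteOf d ((n + 1) * s) (e μ)) - h (x - siteOf d ((n + 1) * s) (e μ)))
      + a / ((n : ℝ) + 1) ^ d * ∑ q ∈ B n (blk n (windowMap d ((n + 1) * s) x)), h (siteOf d ((n + 1) * s) q) + V x * h x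
      = c (siteOf d s (blk n (windowMap d ((n + 1) * s) x)))) (y : Site d s) :
    ∑ z : Fin d → Fin (n + 1), h (siteOf d ((n + 1) * s) (chart n (windowMap d s y) z)) ^ 2
      ≤ ((min 2 a - lam - 2 * d * κ ^ 2 - a * (exp (2 * d * κ) - 1))⁻¹) ^ 2 * (c₁ ^ 2 * ((n : ℝ) + 1) ^ d * exp (2 * d * κ)
          * (2 * (1 - exp (-δ₁))⁻¹) ^ d) * exp (2 * d * κ) * exp (-(2 * κ * ∑ i, (((y i - y₀ i).valMinAbs.natAbs : ℕ) : ℝ))) := by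
  classical
  set m := min 2 a - lam - 2 * d * κ ^ 2 - a * (exp (2 * d * κ) - 1) with hm_def
  set c' : Site d ((n + 1) * s) := siteOf d ((n + 1) * s) (chart n (windowMap d s y₀) 0) with hc'
  set ρ : Site d ((n + 1) * s) → ℝ := fun x => ∑ i, (((x i - c' i).valMinAbs.natAbs : ℕ) : ℝ) with hρ_def
  have hρ : ∀ x μ, |ρ (x + siteOf d ((n + 1) * s) (e μ)) - ρ x| ≤ 1 := fun x μ => torusDist_bond_lipschitz ((n + 1) * s) x c' μ
  have hres := inverseHessian_weighted_resolvent n a s ha hκ0 hκ1 hm V hV ρ hρ h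
    (fun x => c (siteOf d s (blk n (windowMap d ((n + 1) * s) x)))) hh
  have hsrc := weighted_blockLift_sq_le n s hκ0 hδ h2κ y₀ c hc
  -- solution side on the block `y`
  have hsol : exp (2 * (κ * (∑ i, (((y i - y₀ i).valMinAbs.natAbs : ℕ) : ℝ)) - d * κ))
        * ∑ z : Fin d → Fin (n + 1), h (siteOf d ((n + 1) * s) (chart n (windowMap d s y) z)) ^ 2
      ≤ ∑ x, (exp (κ / ((n : ℝ) + 1) * ρ x) * h x) ^ 2 := by
    rw [Finset.mul_sum]
    refine le_trans (Finset.sum_le_sum fun z _ => ?_)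
      (block_sum_le_total n s y (F := fun x => (exp (κ / ((n : ℝ) + 1) * ρ x) * h x) ^ 2) fun x => sq_nonneg _)
    have hw := (weight_on_block n s y y₀ z hκ0).1
    simp only [hρ_def, hc']
    rw [mul_pow, ← exp_nat_mul, Nat.cast_ofNat]
    exact mul_le_mul_of_nonneg_right (exp_le_exp.2 (by linarith)) (sq_nonneg _)
  have hS0 : 0 ≤ ∑ x, (exp (κ / ((n : ℝ) + 1) * ρ x) * h x) ^ 2 := Finset.sum_nonneg fun _ _ => sq_nonneg _
  have hF0 : 0 ≤ ∑ x, (exp (κ / ((n : ℝ) + 1) * ρ x) * c (siteOf d s (blk n (windowMap d ((n + 1) * s) x)))) ^ 2 :=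
    Finset.sum_nonneg fun _ _ => sq_nonneg _
  have hsq : ∑ x, (exp (κ / ((n : ℝ) + 1) * ρ x) * h x) ^ 2
      ≤ (m⁻¹) ^ 2 * (c₁ ^ 2 * ((n : ℝ) + 1) ^ d * exp (2 * d * κ) * (2 * (1 - exp (-δ₁))⁻¹) ^ d) := by
    have h1 := pow_le_pow_left₀ (Real.sqrt_nonneg _) hres 2
    rw [Real.sq_sqrt hS0, mul_pow, Real.sq_sqrt hF0] at h1
    refine h1.trans (mul_le_mul_of_nonneg_left ?_ (sq_nonneg _))
    simpa only [hρ_def, hc'] using hsrc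
  have hexp : 0 < exp (2 * (κ * (∑ i, (((y i - y₀ i).valMinAbs.natAbs : ℕ) : ℝ)) - d * κ)) := exp_pos _
  have key : ∑ z : Fin d → Fin (n + 1), h (siteOf d ((n + 1) * s) (chart n (windowMap d s y) z)) ^ 2
      ≤ (m⁻¹) ^ 2 * (c₁ ^ 2 * ((n : ℝ) + 1) ^ d * exp (2 * d * κ) * (2 * (1 - exp (-δ₁))⁻¹) ^ d)
        / exp (2 * (κ * (∑ i, (((y i - y₀ i).valMinAbs.natAbs : ℕ) : ℝ)) - d * κ)) := by
    rw [le_div_iff₀ hexp, mul_comm]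
    exact hsol.trans hsq
  refine key.trans (le_of_eq ?_)
  rw [div_eq_iff hexp.ne']
  have hE : exp (2 * d * κ) * exp (-(2 * κ * ∑ i, (((y i - y₀ i).valMinAbs.natAbs : ℕ) : ℝ)))
      * exp (2 * (κ * (∑ i, (((y i - y₀ i).valMinAbs.natAbs : ℕ) : ℝ)) - d * κ)) = 1 := by
    rw [← exp_add, ← exp_add, ← exp_zero]; congr 1; ring
  calc (m⁻¹) ^ 2 * (c₁ ^ 2 * ((n : ℝ) + 1) ^ d * exp (2 * d * κ) * (2 * (1 - exp (-δ₁))⁻¹) ^ d)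
      = (m⁻¹) ^ 2 * (c₁ ^ 2 * ((n : ℝ) + 1) ^ d * exp (2 * d * κ) * (2 * (1 - exp (-δ₁))⁻¹) ^ d) * (exp (2 * d * κ)
        * exp (-(2 * κ * ∑ i, (((y i - y₀ i).valMinAbs.natAbs : ℕ) : ℝ)))
        * exp (2 * (κ * (∑ i, (((y i - y₀ i).valMinAbs.natAbs : ℕ) : ℝ)) - d * κ))) := by rw [hE, mul_one]
    _ = _ := by ring

/-! ## §4. THE END: the response to a unit coarse source is exponentially local in block `ℓ²`, unconditionally -/

/-- **HEADLINE — THE RESPONSE TO A UNIT COARSE SOURCE IS EXPONENTIALLY LOCAL IN BLOCK MEAN SQUARE, every field of the two-sided class,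
every mesh, every volume.**  Fix `d`, `a > 0`, `λ < min(2,a)`, `Λ ≥ 0`.  THERE ARE `C, δ > 0` (functions of these only) such that for ALL
`n, s`, ALL `−λ ≤ V ≤ Λ`, ALL block columns `ψ` (`Hψ_{y′} = 𝟙[bt · = y′]`) and every coarse site `y₀`: the fine field
`h_{y₀} := Σ_{y′} T⁻¹(y′,y₀)·ψ_{y′}` (`T` the Schur complement of (134), `T⁻¹` Mathlib's inverse of `Matrix.of T`) satisfies
(i) `Q′t h_{y₀} = e_{y₀}` (block means), (ii) `H h_{y₀} = T⁻¹(bt ·, y₀)` (block-constant) — the two displays DEFINING the road's response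
`Dt e_{y₀}` ((100); `= Dt e_{y₀}` by (133) `action_injective`, cf. (136)) — and (iii) for every block `y`:
`(n+1)^{−d}Σ_z h_{y₀}(σ(chart (wm y) z))² ≤ C·e^{−2δρ_s(y,y₀)}`. [folklore] -/
theorem response_local (a : ℝ) (ha : 0 < a) {lam Lam : ℝ} (hm0 : 0 < min 2 a - lam) (hLam : 0 ≤ Lam) :
    ∃ C δ : ℝ, 0 < C ∧ 0 < δ ∧ ∀ (n s : ℕ) [NeZero s] (V : Site d ((n + 1) * s) → ℝ), (∀ x, -lam ≤ V x) → (∀ x, V x ≤ Lam) →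
      ∀ ψ : Site d s → Site d ((n + 1) * s) → ℝ,
      (∀ y' x, ((n : ℝ) + 1) ^ 2 * ∑ μ, (2 * ψ y' x - ψ y' (x + siteOf d ((n + 1) * s) (e μ)) - ψ y' (x - siteOf d ((n + 1) * s) (e μ)))
        + a / ((n : ℝ) + 1) ^ d * ∑ q ∈ B n (blk n (windowMap d ((n + 1) * s) x)), ψ y' (siteOf d ((n + 1) * s) q) + V x * ψ y' x
        = if siteOf d s (blk n (windowMap d ((n + 1) * s) x)) = y' then 1 else 0) →
      ∀ y₀ : Site d s,
        (∀ y : Site d s, (((n : ℝ) + 1) ^ d)⁻¹ * ∑ z : Fin d → Fin (n + 1), (∑ y', (Matrix.of fun yy y'' : Site d s =>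
              (((n : ℝ) + 1) ^ d)⁻¹ * ∑ z : Fin d → Fin (n + 1), ψ y'' (siteOf d ((n + 1) * s) (chart n (windowMap d s yy) z)))⁻¹ y' y₀
            * ψ y' (siteOf d ((n + 1) * s) (chart n (windowMap d s y) z))) = if y = y₀ then 1 else 0) ∧
        (∀ x : Site d ((n + 1) * s),
          ((n : ℝ) + 1) ^ 2 * ∑ μ, (2 * (∑ y', (Matrix.of fun yy y'' : Site d s =>
              (((n : ℝ) + 1) ^ d)⁻¹ * ∑ z : Fin d → Fin (n + 1), ψ y'' (siteOf d ((n + 1) * s) (chart n (windowMap d s yy) z)))⁻¹ y' y₀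
              * ψ y' x)
            - (∑ y', (Matrix.of fun yy y'' : Site d s =>
              (((n : ℝ) + 1) ^ d)⁻¹ * ∑ z : Fin d → Fin (n + 1), ψ y'' (siteOf d ((n + 1) * s) (chart n (windowMap d s yy) z)))⁻¹ y' y₀
              * ψ y' (x + siteOf d ((n + 1) * s) (e μ)))
            - (∑ y', (Matrix.of fun yy y'' : Site d s =>
              (((n : ℝ) + 1) ^ d)⁻¹ * ∑ z : Fin d → Fin (n + 1), ψ y'' (siteOf d ((n + 1) * s) (chart n (windowMap d s yy) z)))⁻¹ y' y₀
              * ψ y' (x - siteOf d ((n + 1) * s) (e μ))))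
          + a / ((n : ℝ) + 1) ^ d * ∑ q ∈ B n (blk n (windowMap d ((n + 1) * s) x)), (∑ y', (Matrix.of fun yy y'' : Site d s =>
              (((n : ℝ) + 1) ^ d)⁻¹ * ∑ z : Fin d → Fin (n + 1), ψ y'' (siteOf d ((n + 1) * s) (chart n (windowMap d s yy) z)))⁻¹ y' y₀
              * ψ y' (siteOf d ((n + 1) * s) q))
          + V x * (∑ y', (Matrix.of fun yy y'' : Site d s =>
              (((n : ℝ) + 1) ^ d)⁻¹ * ∑ z : Fin d → Fin (n + 1), ψ y'' (siteOf d ((n + 1) * s) (chart n (windowMap d s yy) z)))⁻¹ y' y₀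
              * ψ y' x)
          = (Matrix.of fun yy y'' : Site d s =>
              (((n : ℝ) + 1) ^ d)⁻¹ * ∑ z : Fin d → Fin (n + 1), ψ y'' (siteOf d ((n + 1) * s) (chart n (windowMap d s yy) z)))⁻¹
              (siteOf d s (blk n (windowMap d ((n + 1) * s) x))) y₀) ∧
        (∀ y : Site d s, (((n : ℝ) + 1) ^ d)⁻¹ * ∑ z : Fin d → Fin (n + 1), (∑ y', (Matrix.of fun yy y'' : Site d s =>
              (((n : ℝ) + 1) ^ d)⁻¹ * ∑ z : Fin d → Fin (n + 1), ψ y'' (siteOf d ((n + 1) * s) (chart n (windowMap d s yy) z)))⁻¹ y' y₀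
            * ψ y' (siteOf d ((n + 1) * s) (chart n (windowMap d s y) z))) ^ 2
          ≤ C * exp (-(2 * δ * ∑ i, (((y i - y₀ i).valMinAbs.natAbs : ℕ) : ℝ)))) := by
  classical
  have hd : (0 : ℝ) ≤ d := Nat.cast_nonneg d
  -- the rates: `κ₀` from (131), `(c₁, δ₁)` from (135), `κ = min(κ₀, δ₁∕2)`
  obtain ⟨κ₀, hκ₀0, hκ₀1, hκ₀m⟩ := exists_rate (d := d) a ha.le hm0
  obtain ⟨c₁, δ₁, hc₁, hδ₁, H135⟩ := nextScale_hessian_local (d := d) a ha hm0 hLam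
  set κ : ℝ := min κ₀ (δ₁ / 2) with hκ_def
  have hκ0 : 0 < κ := lt_min hκ₀0 (by linarith)
  have hκ1 : κ ≤ 1 := (min_le_left _ _).trans hκ₀1
  have h2κ : 2 * κ ≤ δ₁ := by have := min_le_right κ₀ (δ₁ / 2); rw [← hκ_def] at this; linarith
  have hmκ : (min 2 a - lam) / 2 ≤ min 2 a - lam - 2 * d * κ ^ 2 - a * (exp (2 * d * κ) - 1) :=
    hκ₀m.trans (rate_mono (d := d) a ha.le hκ0.le (min_le_left _ _))
  have hm : 0 < min 2 a - lam - 2 * d * κ ^ 2 - a * (exp (2 * d * κ) - 1) := lt_of_lt_of_le (by linarith) hmκ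
  set K : ℝ := (2 * (1 - exp (-δ₁))⁻¹) ^ d with hK
  have hK0 : 0 ≤ K := pow_nonneg (mul_nonneg zero_le_two (inv_nonneg.2 (sub_nonneg.2 (exp_le_one_iff.2 (by linarith))))) d
  refine ⟨((min 2 a - lam) / 2)⁻¹ ^ 2 * (c₁ ^ 2 * exp (2 * d * κ) * K) * exp (2 * d * κ) + 1, κ, by positivity, hκ0, ?_⟩
  intro n s _ V hV hV' ψ hψ y₀
  set T : Matrix (Site d s) (Site d s) ℝ := Matrix.of fun yy y'' : Site d s =>
    (((n : ℝ) + 1) ^ d)⁻¹ * ∑ z : Fin d → Fin (n + 1), ψ y'' (siteOf d ((n + 1) * s) (chart n (windowMap d s yy) z)) with hT_def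
  have hvol : (0 : ℝ) < ((n : ℝ) + 1) ^ d := by positivity
  -- (ii) the block-constant display
  have hH : ∀ x : Site d ((n + 1) * s),
      ((n : ℝ) + 1) ^ 2 * ∑ μ, (2 * (∑ y', T⁻¹ y' y₀ * ψ y' x) - (∑ y', T⁻¹ y' y₀ * ψ y' (x + siteOf d ((n + 1) * s) (e μ)))
          - (∑ y', T⁻¹ y' y₀ * ψ y' (x - siteOf d ((n + 1) * s) (e μ))))
        + a / ((n : ℝ) + 1) ^ d * ∑ q ∈ B n (blk n (windowMap d ((n + 1) * s) x)), (∑ y', T⁻¹ y' y₀ * ψ y' (siteOf d ((n + 1) * s) q))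
        + V x * (∑ y', T⁻¹ y' y₀ * ψ y' x)
      = T⁻¹ (siteOf d s (blk n (windowMap d ((n + 1) * s) x))) y₀ := by
    intro x
    rw [action_sum_smul n a s Finset.univ (fun y' => T⁻¹ y' y₀) ψ V x]
    simp only [hψ, mul_ite, mul_one, mul_zero, Finset.sum_ite_eq, Finset.mem_univ, if_true]
  -- invertibility of `T` from the coarse floor
  have hfloor := coarse_floor n a s ha (le_of_lt (by linarith [hm0])) hLam V hV hV' ψ hψ
  have hinj : Function.Injective T.mulVec := by
    intro g₁ g₂ hg
    have hg0 : T.mulVec (g₁ - g₂) = 0 := by rw [Matrix.mulVec_sub, hg, sub_self]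
    have hq : ∑ y, (g₁ - g₂) y * T.mulVec (g₁ - g₂) y = 0 := by rw [hg0]; simp
    have hfl := hfloor (g₁ - g₂)
    have hform : ∑ y, (g₁ - g₂) y * ∑ y', ((((n : ℝ) + 1) ^ d)⁻¹
        * ∑ z : Fin d → Fin (n + 1), ψ y' (siteOf d ((n + 1) * s) (chart n (windowMap d s y) z))) * (g₁ - g₂) y'
        = ∑ y, (g₁ - g₂) y * T.mulVec (g₁ - g₂) y := by
      simp only [hT_def, Matrix.mulVec, dotProduct, Matrix.of_apply]
    rw [hform, hq] at hfl
    have hpos : 0 < 1 / ((36 : ℝ) ^ d * (4 * d + a + Lam)) := by positivity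
    have hS : ∑ y, (g₁ - g₂) y ^ 2 ≤ 0 := not_lt.1 fun hne => (not_le.2 (mul_pos hpos hne)) hfl
    funext y
    have hy : (g₁ - g₂) y ^ 2 ≤ 0 := (Finset.single_le_sum (fun y _ => sq_nonneg ((g₁ - g₂) y)) (Finset.mem_univ y)).trans hS
    have : (g₁ - g₂) y = 0 := by nlinarith [sq_nonneg ((g₁ - g₂) y)]
    simpa [sub_eq_zero] using this
  have hunit : IsUnit T.det := (Matrix.isUnit_iff_isUnit_det T).1 (Matrix.mulVec_injective_iff_isUnit.1 hinj)
  -- (i) the block means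
  have hQ : ∀ y : Site d s, (((n : ℝ) + 1) ^ d)⁻¹ * ∑ z : Fin d → Fin (n + 1), (∑ y', T⁻¹ y' y₀
        * ψ y' (siteOf d ((n + 1) * s) (chart n (windowMap d s y) z))) = if y = y₀ then 1 else 0 := by
    intro y
    have h1 : (T * T⁻¹) y y₀ = if y = y₀ then 1 else 0 := by rw [Matrix.mul_nonsing_inv T hunit, Matrix.one_apply]
    rw [← h1, Matrix.mul_apply]
    simp only [hT_def, Matrix.of_apply, Finset.mul_sum, Finset.sum_mul]
    rw [Finset.sum_comm]
    exact Finset.sum_congr rfl fun y' _ => Finset.sum_congr rfl fun z _ => by ring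
  refine ⟨hQ, hH, fun y => ?_⟩
  -- (iii) block mean square decay
  have hc : ∀ y', |(fun y' => T⁻¹ y' y₀) y'| ≤ c₁ * exp (-(δ₁ * ∑ i, (((y' i - y₀ i).valMinAbs.natAbs : ℕ) : ℝ))) :=
    fun y' => H135 n s V hV hV' ψ hψ y' y₀
  have hblock := blockSq_le_of_decaying_source n s a ha.le hκ0.le hκ1 hm hδ₁ h2κ V hV y₀ (fun y' => T⁻¹ y' y₀) hc
    (fun x => ∑ y', T⁻¹ y' y₀ * ψ y' x) hH y
  have hm2 : ((min 2 a - lam - 2 * d * κ ^ 2 - a * (exp (2 * d * κ) - 1))⁻¹) ^ 2 ≤ ((min 2 a - lam) / 2)⁻¹ ^ 2 := by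
    have h0 : 0 < (min 2 a - lam) / 2 := by linarith
    exact pow_le_pow_left₀ (inv_nonneg.2 hm.le) (inv_anti₀ h0 hmκ) 2
  rw [inv_mul_le_iff₀ hvol]
  refine hblock.trans ?_
  have hE0 : 0 ≤ exp (-(2 * κ * ∑ i, (((y i - y₀ i).valMinAbs.natAbs : ℕ) : ℝ))) := (exp_pos _).le
  have hP0 : 0 ≤ c₁ ^ 2 * ((n : ℝ) + 1) ^ d * exp (2 * d * κ) * K * exp (2 * d * κ)
      * exp (-(2 * κ * ∑ i, (((y i - y₀ i).valMinAbs.natAbs : ℕ) : ℝ))) := by positivity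
  calc ((min 2 a - lam - 2 * d * κ ^ 2 - a * (exp (2 * d * κ) - 1))⁻¹) ^ 2
        * (c₁ ^ 2 * ((n : ℝ) + 1) ^ d * exp (2 * d * κ) * K) * exp (2 * d * κ)
        * exp (-(2 * κ * ∑ i, (((y i - y₀ i).valMinAbs.natAbs : ℕ) : ℝ)))
      = ((min 2 a - lam - 2 * d * κ ^ 2 - a * (exp (2 * d * κ) - 1))⁻¹) ^ 2
        * (c₁ ^ 2 * ((n : ℝ) + 1) ^ d * exp (2 * d * κ) * K * exp (2 * d * κ)
        * exp (-(2 * κ * ∑ i, (((y i - y₀ i).valMinAbs.natAbs : ℕ) : ℝ)))) := by ring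
    _ ≤ ((min 2 a - lam) / 2)⁻¹ ^ 2 * (c₁ ^ 2 * ((n : ℝ) + 1) ^ d * exp (2 * d * κ) * K * exp (2 * d * κ)
        * exp (-(2 * κ * ∑ i, (((y i - y₀ i).valMinAbs.natAbs : ℕ) : ℝ)))) := mul_le_mul_of_nonneg_right hm2 hP0
    _ = ((n : ℝ) + 1) ^ d * ((((min 2 a - lam) / 2)⁻¹ ^ 2 * (c₁ ^ 2 * exp (2 * d * κ) * K) * exp (2 * d * κ))
        * exp (-(2 * κ * ∑ i, (((y i - y₀ i).valMinAbs.natAbs : ℕ) : ℝ)))) := by ring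
    _ ≤ ((n : ℝ) + 1) ^ d * ((((min 2 a - lam) / 2)⁻¹ ^ 2 * (c₁ ^ 2 * exp (2 * d * κ) * K) * exp (2 * d * κ) + 1)
        * exp (-(2 * κ * ∑ i, (((y i - y₀ i).valMinAbs.natAbs : ℕ) : ℝ)))) :=
        mul_le_mul_of_nonneg_left (mul_le_mul_of_nonneg_right (le_add_of_nonneg_right zero_le_one) hE0) hvol.le

/-! ## §5. Toy -/

/-- Toy: the rate window is monotone (`rate_mono` at `κ′ = 0`): the plain floor dominates every windowed floor. -/
example (a lam κ : ℝ) (ha : 0 ≤ a) (hκ : 0 ≤ κ) :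
    min 2 a - lam - 2 * (3 : ℕ) * κ ^ 2 - a * (exp (2 * (3 : ℕ) * κ) - 1) ≤ min 2 a - lam - 2 * (3 : ℕ) * 0 ^ 2 - a * (exp (2 * (3 : ℕ) * 0) - 1) :=
  rate_mono (d := 3) a ha le_rfl hκ

end Summit.QuantumFields.BalabanUV.T4Continuum.NE7b.SupTorusResponseLocality
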